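import Literature.AnabelianGeometry.AbsoluteAnabelian.MLFGaloisJannsenWingbergTwists
import HarnessLib

/-!
# The Diekert generators of `G_k` at a DYADIC field containing `√−1`, read through local class field theory, and the twist
# `x_d ↦ x_d x_{d−1}` of the presentation (named fact, group level; the `p = 2` counterpart of `JannsenWingbergTwists`)

V. Diekert, *Über die absolute Galoisgruppe dyadischer Zahlkörper*, J. reine angew. Math. **350** (1984) 152–172 [Diekert1984],
Thm. 3.1, AS RESTATED in Y. Nishio, *On the Outer Automorphism Groups of the Absolute Galois Groups of 2-adic local Fields*
(arXiv:2512.05095, 2025) [Nishio2025OuterAutDyadic], §2 Prop. 2.1 «(Diekert)» (held store text `paper:arxiv-2512.05095`, corpus-tex chunks: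
Prop. 2.1 = p0005 l.66–92, its proof l.94–95, Lem. 2.3 p0005 l.125 – p0006 l.3, Lem. 2.4 p0006 l.5–10, Def. 2.5 p0006 l.12–14, Thm. 2.6
p0006 l.16–21; read first-hand by this seat and by abc-iut-lit g14) — for a group `G` of MLF-type with `p(G) = 2` and
`a(G) ≥ 2` (i.e. `k ∋` a primitive `4`-th root of unity): «There exist topological generators `σ`, `τ`, `x_0, …, x_{d(G)}` of `G`,
positive integers `s`, `g` such that `g ≠ 1`, … that satisfy the following three conditions: (1) The normal closed subgroup `P(G)` of
`G` is topologically normally generated by `x_0, …, x_{d(G)}`. (2) The equality `στσ⁻¹ = τ^{q(G)}` holds, where we write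
`q(G) := 2^{f(G)}`. (3) The equality `σx_0σ⁻¹ = (x_0τ)^{πg} x_1^{2^s} [x_1,x_2] ⋯ [x_{d(G)−1},x_{d(G)}]` holds, where we write `π` for
the unique element of `Ẑ = ∏_p ℤ_p` whose image in `ℤ_p` is given by `1` if `p = 2` (resp. by `0` if `p ≠ 2`).»  («Proof. This
assertion follows from [Diekert1984], Theorem 3.1, and [Hoshi1], Proposition 3.6, [Hoshi2], Proposition 2.5, (i).»)  Proof of
Lemma 2.3: «`{z_i}_{i∈S}` topologically generates `𝒪^≺(G)^{ab/tor}` (`⊆ G^{ab/tor}`) [cf. [Hoshi1], Definition 3.10, (i), (ii)] …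
it follows from the condition (2) … that the image of `τ` in `G^{ab/tor}` is trivial. Thus, it follows from the condition (3) … that
the relation `1 = z_0^H z_1^{2^s}` in `𝒪^≺(G)^{ab/tor}` holds for some nonzero [cf. the condition that `g ≠ 1` …] integer `H`.»
Def. 2.5: «We shall write `α` for the automorphism of `G` defined by the equalities `α(σ) = σ`, `α(τ) = τ`, `α(x_{d(G)}) =
x_{d(G)} x_{d(G)−1}`, and `α(x_i) = x_i` for `i ∈ S ∖ {d(G)}`. Since `α` induces a bijection between the set of generators of `G`
and preserves the defining relations of `G` [cf. Proposition 2.1], it indeed defines an automorphism of `G`.»  (Consequences in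
print, NOT typed here: Lemma 2.3 «the `d(G)` elements `y_1, …, y_{d(G)}` form a basis of the `ℚ_2`-vector space `k_+(G)`»; Thm. 2.6
«`α^n_+ ≠ id`, and … `(α^n_+ − id)² = 0`»; Cor. 2.7 (i) «the image of … `Out(G) → Aut(k_+(G))` is infinite»; §3 Thm. 3.5: for `k`
absolutely abelian with `a_k ≥ 2` some `α ∈ Aut(G_k)` has `α^n` not `(ℚ_2)_+`-characteristic for every `n ≠ 0`.)

TYPED HERE (abc-iut cell, seat abc-iut-c312-1 gen 23, offer (υ) «C:P2-DIEKERT-TWIST»; the `p = 2` residual of the global identity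
AS TYPED, row R32 `Thm311RealInd1StripGlobalDichotomy`) as ONE named fact `DiekertNishioTwists` at the GROUP LEVEL, in EXACTLY
the vocabulary and the clause template of `JannsenWingbergTwists` (same directory, p500987 lane: MLF `k` of characteristic `0`,
`Field.absoluteGaloisGroup k`, THE reciprocity map `(isReciprocitySystemE (isClassFieldTheory_localWeilDatum k)).theta`, the same
GLOSS `𝒪^≺(G_k) := Im(P(G_k) → G_k^{ab}) ≅ 𝒪_k^≺` — Nishio §2 recalls it verbatim: «the module `𝒪^≺(G)` is defined to be the
image of `P(G) ⊆ G` in `G^{ab}`», «there exist functorial isomorphisms `𝒪^≺_k ⥲ 𝒪^≺(G_k)`, `k^× ⥲ k^×(G_k)`, and `k_+ ⥲ k_+(G_k)`»),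
with the residue characteristic `2`, the hypothesis `p ≠ 2` REPLACED by «`k` contains a square root of `−1`» (`a(G) ≥ 2`), and ONE
twist `JWTwist σ τ x d (d−1) d` (Def. 2.5) in place of Kondo's plane twists:
* `σ, τ, x_0, …, x_d` topologically generate `G_k` (Prop. 2.1 «topological generators»);
* `στσ⁻¹ = τ^q`, `q = #𝓀_k = 2^{f}` (condition (2));
* `[x_j] = θ(u_j)` with `u_j` a principal unit, `j ≤ d`, and the `u_j` topologically generate the principal units (condition (1)
  read in `G_k^{ab} ⊇ 𝒪^≺(G_k) ≅ 𝒪_k^≺`; proof of Lemma 2.3);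
* `u_0^H · u_1^{2^s}` is torsion, `s > 0`, `H ≠ 0` (the abelianised relation (3), proof of Lemma 2.3 verbatim);
* the twist `α`: a topological automorphism of `G_k` fixing `σ, τ, x_j` (`j ≠ d`) with `α(x_d) = x_d x_{d−1}` (Def. 2.5).
-- TODO(general form): relation (3) itself (`(x_0τ)^{πg}` with the `Ẑ`-exponent `π`) and the presentation of `G` as a
-- universal property are NOT typed (no free pro-`𝔊` operator groups in the tree) — exactly as for `JannsenWingbergTwists`; only
-- the consequences print draws from them are.  Thm. 3.5's base-line mover for absolutely abelian `k` (restriction to the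
-- characteristic subgroup `G_k ⊆ G_{k'}`, Lemma 3.4 / Jarden–Ritter) is NOT part of this fact.
What this fact is FOR: every base field `F` of an initial Θ-datum contains `√−1` ([IUTchI] Def. 3.1 (a); tree
`InitialThetaDataArith.sqrt_neg_one_mem`), so EVERY dyadic place of `K ⊇ F` is in the case `a(G) ≥ 2`; the (Ind1) strip part of
[IUTchIII] Thm. 3.11 (i) AS TYPED by the abc-iut-c312-1 lineage (`Summits/ABC/IUTFork/Thm311RealInd1StripTwistJW*.lean`) reads its
twists from `JannsenWingbergTwists` (`p ≠ 2`) and therefore has no engine at the prime `2`, which is a support prime of every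
Θ-volume input (`two_mem_supportPrimes`); the consumer of THIS fact is the `p = 2` twin of `Real.dehnTwists_closureAt_of_jannsenWingberg`
(the unipotent shear `y_d ↦ y_d + y_{d−1}` of `K_v` realised through THE equivariant lift, Nishio Thm. 2.6 in kernel form).
A classical/recent result about `G_k`; a 2025 preprint restating a 1984 theorem — flag (α) of plan/FACT-LIST-PLACEMENT-IUTch.md
(preprint) applies to Def. 2.5 / Lemma 2.3's sentences, Diekert's Thm. 3.1 itself is refereed print; nothing here bears on
[IUTchIII] Cor. 3.12; no side taken; a named fact is an assumption with a citation; typed ≠ proved.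
[cite: Nishio2025OuterAutDyadic, Prop. 2.1 (= Diekert1984 Thm. 3.1), Def. 2.5, Lem. 2.3–2.4, Thm. 2.6]
[cite: Diekert1984, Thm. 3.1 (J. reine angew. Math. 350, pp. 152–172)]
[cite: HoshiNishio2022OuterAutMLF, Prop 1.1 and proof of Lemma 1.3 p.5] [cite: JannsenWingberg1982, §5.1 p.96]
-/

noncomputable section

namespace Literature.AnabelianGeometry.AbsoluteAnabelian

open Field ValuativeRel
open Literature.NumberTheory.GaloisRepresentations Literature.NumberTheory.GaloisRepresentations.LocalWeilDatum
open scoped ValuativeRel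

/-- **Diekert generators of `G_k` at a dyadic field containing `√−1`, read through the reciprocity map, with the twist
`x_d ↦ x_d x_{d−1}`.**  For an MLF `k` of characteristic `0` with residue characteristic `p = 2`, containing a square root of
`−1` (Nishio: `a(G) ≥ 2`), `d := [k : ℚ_2] ≥ 2`, `G_k = Gal(k̄/k)` (standard closure, Krull topology) and `θ : kˣ → G_k^{ab}` THE
local reciprocity map: there are `σ, τ, x_0, …, x_d ∈ G_k`, principal units `u_0, …, u_d` (`|u_j − 1| < 1`), a positive integer `s`
and a nonzero integer `H` such that
* `σ, τ, x_0, …, x_d` topologically generate `G_k` (Nishio Prop. 2.1 «topological generators `σ`, `τ`, `x_0, …, x_{d(G)}` of `G`»;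
  Diekert Thm. 3.1);
* `στσ⁻¹ = τ^q`, `q = #𝓀_k` (condition (2) «`στσ⁻¹ = τ^{q(G)}` … `q(G) := 2^{f(G)}`»);
* `[x_j] = θ(u_j)` in `G_k^{ab}` for `j ≤ d` — the `x_j` lie in `P(G_k)`, whose image in `G_k^{ab}` is `𝒪^≺(G_k) ≅ 𝒪_k^≺`
  (Nishio §2 «the module `𝒪^≺(G)` is defined to be the image of `P(G) ⊆ G` in `G^{ab}`», «functorial isomorphisms
  `𝒪^≺_k ⥲ 𝒪^≺(G_k)` …»; the gloss of `JannsenWingbergTwists`);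
* the `u_j` topologically generate the principal units (condition (1) «`P(G)` … is topologically normally generated by
  `x_0, …, x_{d(G)}`» read in `G_k^{ab}`; proof of Lemma 2.3 «`{z_i}_{i∈S}` topologically generates `𝒪^≺(G)^{ab/tor}`»);
* `u_0^H · u_1^{2^s}` is torsion (proof of Lemma 2.3 «the relation `1 = z_0^H z_1^{2^s}` in `𝒪^≺(G)^{ab/tor}` holds for some
  nonzero … integer `H`»);
* the twist of Def. 2.5: `JWTwist σ τ x d (d−1) d` — a topological automorphism `α` of `G_k` with `α(σ) = σ`, `α(τ) = τ`,
  `α(x_j) = x_j` (`j ≤ d`, `j ≠ d`), `α(x_d) = x_d x_{d−1}` («it indeed defines an automorphism of `G`»).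
-- TODO(general form): the presentation and relation (3) `σx_0σ⁻¹ = (x_0τ)^{πg} x_1^{2^s} [x_1,x_2]⋯[x_{d−1},x_d]` verbatim are
-- not typed; see the module docstring.  Only the ONE twist `α` of Def. 2.5 is recorded (`JWTwist`, not `JWTwistPair`): the
-- partner `x_{d−1} ↦ x_{d−1} x_d⁻¹` is in no source and does not fix relation (3) at `d = 2` (the factor `x_1^{2^s}`).
[cite: Nishio2025OuterAutDyadic, Prop. 2.1 (= Diekert1984 Thm. 3.1), Def. 2.5, Lem. 2.3–2.4, Thm. 2.6]
[cite: Diekert1984, Thm. 3.1 (J. reine angew. Math. 350, pp. 152–172)] -/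
def DiekertNishioTwists : Prop :=
  ∀ (k : Type) [Field k] [ValuativeRel k] [TopologicalSpace k] [IsNonarchimedeanLocalField k] [CharZero k]
    (p : ℕ) [Fact p.Prime] (hp : valuation k p < 1), p = 2 → (∃ i : k, i ^ 2 = -1) →
    letI : Algebra ℚ_[p] k := LocalField.padicAlgebra k p hp
    haveI : ValuativeExtension k k := ⟨fun _ _ => Iff.rfl⟩
    2 ≤ Module.finrank ℚ_[p] k →
      ∃ (σ τ : absoluteGaloisGroup k) (x : ℕ → absoluteGaloisGroup k) (u : ℕ → kˣ) (s : ℕ) (H : ℤ),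
        -- topological generation of `G_k` by `σ, τ, x_0, …, x_d`
        (Subgroup.closure ({σ, τ} ∪ x '' Set.Iic (Module.finrank ℚ_[p] k))).topologicalClosure = ⊤ ∧
        -- the tame relation (condition (2))
        σ * τ * σ⁻¹ = τ ^ Nat.card 𝓀[k] ∧
        -- the wild generators read through `θ`: `[x_j] = θ(u_j)`, `u_j` a principal unit
        (∀ j ≤ Module.finrank ℚ_[p] k,
          valuation k ((u j : k) - 1) < 1 ∧
          absGaloisAbProj k (x j) =
            (isReciprocitySystemE (F := k) (E := k) (isClassFieldTheory_localWeilDatum k)).theta (u j)) ∧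
        -- the `u_j` topologically generate the principal units `{w : |w - 1| < 1}` (closure in `kˣ`)
        (∀ w : kˣ, valuation k ((w : k) - 1) < 1 →
          w ∈ (Subgroup.closure (u '' Set.Iic (Module.finrank ℚ_[p] k))).topologicalClosure) ∧
        -- the abelianised relation (3): `u_0^H u_1^{2^s}` is torsion, `s > 0`, `H ≠ 0`
        0 < s ∧ H ≠ 0 ∧ IsOfFinOrder (u 0 ^ H * u 1 ^ (p ^ s)) ∧
        -- Nishio's twist `α` of Def. 2.5 on the LAST pair `(x_{d−1}, x_d)`: `α(x_d) = x_d x_{d−1}`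
        JWTwist σ τ x (Module.finrank ℚ_[p] k) (Module.finrank ℚ_[p] k - 1) (Module.finrank ℚ_[p] k)

end Literature.AnabelianGeometry.AbsoluteAnabelian

end
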